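import Summits.PneNP.Statement
import Literature.Computability.Complexity.ClayProblem
import Literature.Computability.Complexity.Classes
import Literature.Computability.Complexity.Nondeterministic

/-!
# PneNP / proofcplx — assembly

Route `PneNP/proofcplx` (propositional proof complexity), item `stmt-PneNP-0042` (assembly):
`NP ≠ coNP` implies `P ≠ NP`, given as hypotheses the Literature named facts
`Literature.Computability.Complexity.P_subset_NP` (`P ⊆ NP`), the two model bridges `Literature.PNP.P Bool = CplxCore.P`,
`Literature.PNP.NP Bool = CplxCore.NP`, and `Literature.Computability.Complexity.co_P` (`co P = P`).
Argument (Arora–Barak 2009, §2.6.1): if `P = NP` then `coNP = co P = P = NP`.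
The hypothesis `P ⊆ NP` is load-bearing: from `¬ PneNP` the bridges only give `NP ⊆ P`, and
`NP ⊆ P ∧ co P = P` does not force `NP = co NP` at the level of abstract set inclusions
(grounders ground-pool-1 and ground-pool-2, refuter check 2026-08-13).
-/

namespace Literature.CplxMeta

open Literature.Computability.Complexity

/-- Settles `stmt-PneNP-0042` (assembly of route proofcplx): `P ⊆ NP`, the two model bridges and
`co P = P` turn `NP ≠ coNP` into `PneNP`. [folklore] -/
theorem proofcplx_assembly :
    Literature.Computability.Complexity.P_subset_NP → Literature.Computability.Complexity.P_bool_eq → Literature.Computability.Complexity.NP_bool_eq → Literature.Computability.Complexity.co_P →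
      Literature.Computability.Complexity.Nondeterministic.NP ≠ Literature.Computability.Complexity.coNP → PneNP := by
  intro hPNP hP hNP hco hne
  by_contra h
  apply hne
  have hsub : Nondeterministic.NP ⊆ Classes.P := by
    intro L hL
    by_contra hL'
    apply h
    refine ⟨L, ?_, ?_⟩
    · show L ∈ Literature.Computability.Complexity.PNPWave0.NP Bool
      rw [show Literature.Computability.Complexity.PNPWave0.NP Bool = _ from hNP]; exact hL
    · show L ∉ Literature.Computability.Complexity.PNPWave0.P Bool
      rw [show Literature.Computability.Complexity.PNPWave0.P Bool = _ from hP]; exact hL'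
  have heq : Nondeterministic.NP = Classes.P := Set.Subset.antisymm hsub hPNP
  show Nondeterministic.NP = co Nondeterministic.NP
  rw [heq]
  exact hco.symm

end Literature.CplxMeta
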